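import Literature.Barriers.CriticalPhenomena.SAPAnisotropicNotDFinite242HadamardProofs
import HarnessLib

/-!
# Move words: canonical building-block words as eight signed runs (towards Lemma 21)

Companion of `Literature/Barriers/CriticalPhenomena/SAPAnisotropicNotDFinite242Hadamard.lean`
(A. Rechnitzer, *Haruspicy 2: The anisotropic generating function of self-avoiding polygons is
not D-finite*, J. Combin. Theory Ser. A 113 (2006) 520–546; arXiv:math/0406450v2, §3.3), towards
the discharge of `Rechnitzer2006_eq29` through **Lemma 21** (the generating function of the
2-4-2 building blocks), whose combinatorial content is the classification of the canonical
building-block words `bbWords M t w` (`SAPAnisotropicNotDFinite242Words`: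
`bbCount M t w = #bbWords M t w`).

A **move** is a straight horizontal run of signed length `ℓ ∈ ℤ` (`E^ℓ` for `ℓ ≥ 0`, `W^{-ℓ}`
for `ℓ < 0`) followed by one vertical letter (`N` or `S`); every canonical SAP word is the
concatenation `movesWord ms` of the moves read off it (`movesOf`, `movesWord_movesOf`: the runs
of a self-avoiding word are straight, `IsSAP.getElem_eq_of_horizontal`, and a canonical word ends
with `S`). This file develops the elementary theory of move words — vertices
(`vtx_movesWord`), letter counts, the horizontal steps on a line (`card_hsteps_movesWord`) and
the vertical bonds of a row (`card_cross_movesWord`), and self-avoidance as DISJOINTNESS OF THE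
CLOSED RUNS ON EACH LINE (`injOn_movesWord`, `disjoint_of_injOn`) — and proves the
**classification of building blocks** (the printed Figure 11, "the four possible orientations of a
building block", made precise): a word lies in `bbWords M t w` iff it is `movesWord` of EIGHT
moves `(ℓ₀,N)(ℓ₁,·)⋯(ℓ₇,S)` whose up/down pattern is `NNNSSNSS` (heights of the runs
`0,1,2,3,2,1,2,1`: shape `A`) or `NNSNNSSS` (heights `0,1,2,1,2,3,2,1`: shape `B`), with
`Σ ℓ_k = 0`, `ℓ₀ = w ≥ 1` (the bottom row), `|ℓ_top| = t` (the top row, `top = 3`, resp. `5`),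
`Σ |ℓ_k| = 2M`, and the three closed runs on each of the lines `y = 1`, `y = 2` pairwise disjoint
(`BBValid`; `BBValid.mem_bbWords`, `exists_bbValid_of_mem_bbWords`, `movesWord_bbMoves_injective`).
The enumeration of these data (Lemma 21 proper) is the sibling `SAPBuildingBlocksPatterns`.

## References

* A. Rechnitzer, *Haruspicy 2*, op. cit., §3.3, Lemma 21 and Figures 11–13.
  [Rechnitzer2006Haruspicy2]
* N. Madras, G. Slade, *The Self-Avoiding Walk*, Birkhäuser 1993, Definition 3.2.1.
  [MadrasSlade1993]
-/

noncomputable section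

open Finset Literature.Probability.LatticeModels Literature.Probability.Percolation
open scoped BigOperators

namespace Literature.Barriers.CriticalPhenomena

namespace Haruspicy

open Edwards2D

/-! ### Moves and move words -/

section Moves

/-- A move: a straight horizontal run of signed length `ℓ` (`E^ℓ` if `ℓ ≥ 0`, `W^{-ℓ}` if `ℓ < 0`)
followed by one vertical letter (`N` if the flag is `true`, `S` otherwise). [folklore] -/
abbrev Move := ℤ × Bool

/-- The letter of a run of signed length `ℓ`. [folklore] -/
def hletter (ℓ : ℤ) : Fin 4 := if 0 ≤ ℓ then 0 else 1

/-- The vertical letter of a move. [folklore] -/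
def vletter (u : Bool) : Fin 4 := if u then 2 else 3

/-- The direction `±1` of a run of signed length `ℓ`. [folklore] -/
def msgn (ℓ : ℤ) : ℤ := if 0 ≤ ℓ then 1 else -1

/-- The vertical displacement `±1` of a move. [folklore] -/
def mdy (u : Bool) : ℤ := if u then 1 else -1

/-- The word of a move. [folklore] -/
def moveWord (m : Move) : List (Fin 4) :=
  List.replicate m.1.natAbs (hletter m.1) ++ [vletter m.2]

/-- The word of a list of moves. [folklore] -/
def movesWord : List Move → List (Fin 4)
  | [] => []
  | m :: ms => moveWord m ++ movesWord ms

/-- The index in `movesWord ms` at which the `k`-th move starts. [folklore] -/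
def mstart : List Move → ℕ → ℕ
  | _, 0 => 0
  | [], _ + 1 => 0
  | m :: ms, k + 1 => (m.1.natAbs + 1) + mstart ms k

/-- The column at which the `k`-th move starts (`Σ_{i<k} ℓ_i`). [folklore] -/
def mX : List Move → ℕ → ℤ
  | _, 0 => 0
  | [], _ + 1 => 0
  | m :: ms, k + 1 => m.1 + mX ms k

/-- The height at which the `k`-th move runs (`Σ_{i<k} ±1`). [folklore] -/
def mY : List Move → ℕ → ℤ
  | _, 0 => 0
  | [], _ + 1 => 0
  | m :: ms, k + 1 => mdy m.2 + mY ms k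

/-- The signed length of the `k`-th move (junk `0` past the end). [folklore] -/
def mL (ms : List Move) (k : ℕ) : ℤ := (ms.getD k (0, false)).1

/-- The vertical flag of the `k`-th move (junk past the end). [folklore] -/
def mU (ms : List Move) (k : ℕ) : Bool := (ms.getD k (0, false)).2

variable (m : Move) (ms : List Move)

/-- No move starts before index `0`. [folklore] -/
@[simp] theorem mstart_zero : mstart ms 0 = 0 := by cases ms <;> rfl
/-- The first move starts in column `0`. [folklore] -/
@[simp] theorem mX_zero : mX ms 0 = 0 := by cases ms <;> rfl
/-- The first move runs at height `0`. [folklore] -/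
@[simp] theorem mY_zero : mY ms 0 = 0 := by cases ms <;> rfl
/-- `mstart` unfolds. [folklore] -/
@[simp] theorem mstart_cons_succ (k : ℕ) : mstart (m :: ms) (k + 1) = (m.1.natAbs + 1) + mstart ms k := rfl
/-- `mX` unfolds. [folklore] -/
@[simp] theorem mX_cons_succ (k : ℕ) : mX (m :: ms) (k + 1) = m.1 + mX ms k := rfl
/-- `mY` unfolds. [folklore] -/
@[simp] theorem mY_cons_succ (k : ℕ) : mY (m :: ms) (k + 1) = mdy m.2 + mY ms k := rfl
/-- `mL` unfolds. [folklore] -/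
@[simp] theorem mL_cons_zero : mL (m :: ms) 0 = m.1 := rfl
/-- `mL` unfolds. [folklore] -/
@[simp] theorem mL_cons_succ (k : ℕ) : mL (m :: ms) (k + 1) = mL ms k := rfl
/-- `mU` unfolds. [folklore] -/
@[simp] theorem mU_cons_zero : mU (m :: ms) 0 = m.2 := rfl
/-- `mU` unfolds. [folklore] -/
@[simp] theorem mU_cons_succ (k : ℕ) : mU (m :: ms) (k + 1) = mU ms k := rfl
/-- `movesWord` unfolds. [folklore] -/
@[simp] theorem movesWord_nil : movesWord [] = [] := rfl
/-- `movesWord` unfolds. [folklore] -/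
@[simp] theorem movesWord_cons : movesWord (m :: ms) = moveWord m ++ movesWord ms := rfl

/-- `msgn` is a sign. [folklore] -/
theorem msgn_cases (ℓ : ℤ) : (0 ≤ ℓ ∧ msgn ℓ = 1) ∨ (ℓ < 0 ∧ msgn ℓ = -1) := by
  unfold msgn; split_ifs with h
  · exact Or.inl ⟨h, rfl⟩
  · exact Or.inr ⟨not_le.mp h, rfl⟩

/-- `mdy` is a sign. [folklore] -/
theorem mdy_cases (u : Bool) : (u = true ∧ mdy u = 1) ∨ (u = false ∧ mdy u = -1) := by
  cases u <;> simp [mdy]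

/-- `msgn ℓ · |ℓ| = ℓ`. [folklore] -/
theorem msgn_mul_natAbs (ℓ : ℤ) : msgn ℓ * (ℓ.natAbs : ℤ) = ℓ := by
  rcases msgn_cases ℓ with ⟨h, e⟩ | ⟨h, e⟩ <;> rw [e] <;> omega

/-- The step of the run letter: `(msgn ℓ, 0)`. [folklore] -/
theorem stepVec_hletter (ℓ : ℤ) : stepVec (hletter ℓ) 0 = msgn ℓ ∧ stepVec (hletter ℓ) 1 = 0 := by
  unfold hletter msgn
  split_ifs <;> simp

/-- The step of the vertical letter: `(0, mdy u)`. [folklore] -/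
theorem stepVec_vletter (u : Bool) : stepVec (vletter u) 0 = 0 ∧ stepVec (vletter u) 1 = mdy u := by
  cases u <;> simp [vletter, mdy]

/-- The run letter is horizontal. [folklore] -/
theorem hletter_val_lt (ℓ : ℤ) : (hletter ℓ).val < 2 := by
  unfold hletter; split_ifs <;> decide

/-- The vertical letter is vertical. [folklore] -/
theorem vletter_val_ge (u : Bool) : 2 ≤ (vletter u).val := by
  cases u <;> decide

/-- Length of a move word. [folklore] -/
@[simp] theorem length_moveWord : (moveWord m).length = m.1.natAbs + 1 := by
  simp [moveWord]

/-- Length of a move-list word: the start of the move past the end. [folklore] -/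
theorem length_movesWord : (movesWord ms).length = mstart ms ms.length := by
  induction ms with
  | nil => rfl
  | cons m ms ih => rw [movesWord_cons, List.length_append, length_moveWord, List.length_cons,
      mstart_cons_succ, ih]

/-- Horizontal letters of a move word. [folklore] -/
@[simp] theorem hcount_moveWord : hcount (moveWord m) = m.1.natAbs := by
  rw [moveWord, hcount_append, hcount_singleton, if_neg (by have := vletter_val_ge m.2; omega),
    Nat.add_zero, hcount, List.countP_replicate, if_pos (by simpa using hletter_val_lt m.1)]

/-- The total number of horizontal letters `Σ_k |ℓ_k|`. [folklore] -/
def mh : List Move → ℕ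
  | [] => 0
  | m :: ms => m.1.natAbs + mh ms

/-- Horizontal letters of a move-list word. [folklore] -/
theorem hcount_movesWord : hcount (movesWord ms) = mh ms := by
  induction ms with
  | nil => rfl
  | cons m ms ih => rw [movesWord_cons, hcount_append, hcount_moveWord, ih]; rfl

/-- `|movesWord ms| = Σ |ℓ_k| + (number of moves)`. [folklore] -/
theorem length_movesWord_eq_mh : (movesWord ms).length = mh ms + ms.length := by
  induction ms with
  | nil => rfl
  | cons m ms ih =>
    rw [movesWord_cons, List.length_append, length_moveWord, ih, List.length_cons]
    simp only [mh]; omega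

/-- The start of move `k + 1`. [folklore] -/
theorem mstart_succ {k : ℕ} (hk : k < ms.length) :
    mstart ms (k + 1) = mstart ms k + (mL ms k).natAbs + 1 := by
  induction ms generalizing k with
  | nil => simp at hk
  | cons m ms ih =>
    cases k with
    | zero => simp [mstart, mL]
    | succ k =>
      rw [mstart_cons_succ, mstart_cons_succ, ih (by simpa using hk), mL_cons_succ]; omega

/-- `mstart` is monotone. [folklore] -/
theorem mstart_mono {k k' : ℕ} (hkk' : k ≤ k') (hk' : k' ≤ ms.length) : mstart ms k ≤ mstart ms k' := by
  induction k', hkk' using Nat.le_induction with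
  | base => exact le_rfl
  | succ k' hkk' ih => rw [mstart_succ ms (by omega)]; have := ih (by omega); omega

/-- The runs of different moves occupy disjoint index ranges. [folklore] -/
theorem mstart_add_natAbs_lt {k k' : ℕ} (hkk' : k < k') (hk' : k' ≤ ms.length) :
    mstart ms k + (mL ms k).natAbs < mstart ms k' := by
  have h1 := mstart_succ ms (show k < ms.length by omega)
  have h2 := mstart_mono ms (show k + 1 ≤ k' by omega) hk'
  omega

/-- The column after move `k`. [folklore] -/
theorem mX_succ {k : ℕ} (hk : k < ms.length) : mX ms (k + 1) = mX ms k + mL ms k := by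
  induction ms generalizing k with
  | nil => simp at hk
  | cons m ms ih =>
    cases k with
    | zero => simp [mX, mL]
    | succ k => rw [mX_cons_succ, mX_cons_succ, ih (by simpa using hk), mL_cons_succ]; ring

/-- The height after move `k`. [folklore] -/
theorem mY_succ {k : ℕ} (hk : k < ms.length) : mY ms (k + 1) = mY ms k + mdy (mU ms k) := by
  induction ms generalizing k with
  | nil => simp at hk
  | cons m ms ih =>
    cases k with
    | zero => simp [mY, mU]
    | succ k => rw [mY_cons_succ, mY_cons_succ, ih (by simpa using hk), mU_cons_succ]; ring

/-- The steps of a move word sum to `(ℓ, ±1)`. [folklore] -/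
theorem sum_moveWord : ((moveWord m).map stepVec).sum 0 = m.1 ∧ ((moveWord m).map stepVec).sum 1 = mdy m.2 := by
  simp only [moveWord, List.map_append, List.map_cons, List.map_nil, List.sum_append, List.sum_cons,
    List.sum_nil, add_zero, sum_replicate_stepVec, Pi.add_apply, Pi.smul_apply]
  obtain ⟨h0, h1⟩ := stepVec_hletter m.1
  obtain ⟨v0, v1⟩ := stepVec_vletter m.2
  rw [h0, h1, v0, v1, nsmul_eq_mul, mul_comm, msgn_mul_natAbs]
  simp

/-- The steps of a move-list word sum to `(mX, mY)` at the end. [folklore] -/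
theorem sum_movesWord : ((movesWord ms).map stepVec).sum 0 = mX ms ms.length ∧
    ((movesWord ms).map stepVec).sum 1 = mY ms ms.length := by
  induction ms with
  | nil => simp
  | cons m ms ih =>
    simp only [movesWord_cons, List.map_append, List.sum_append, Pi.add_apply, List.length_cons,
      mX_cons_succ, mY_cons_succ, ih.1, ih.2, (sum_moveWord m).1, (sum_moveWord m).2, and_self]

/-- Vertices inside a move word: the run. [folklore] -/
theorem vtx_moveWord {j : ℕ} (hj : j ≤ m.1.natAbs) :
    vtx (moveWord m) j 0 = msgn m.1 * j ∧ vtx (moveWord m) j 1 = 0 := by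
  rw [moveWord, vtx_append_left _ _ (by simpa using hj), vtx_replicate _ _ hj]
  obtain ⟨h0, h1⟩ := stepVec_hletter m.1
  simp [h0, h1, mul_comm]

/-- **Vertices of a move-list word**: the `j`-th vertex of move `k` is `(X_k + msgn ℓ_k · j, Y_k)`.
[folklore] -/
theorem vtx_movesWord {k : ℕ} (hk : k < ms.length) {j : ℕ} (hj : j ≤ (mL ms k).natAbs) :
    vtx (movesWord ms) (mstart ms k + j) 0 = mX ms k + msgn (mL ms k) * j ∧
      vtx (movesWord ms) (mstart ms k + j) 1 = mY ms k := by
  induction ms generalizing k with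
  | nil => simp at hk
  | cons m ms ih =>
    cases k with
    | zero =>
      simp only [mstart_zero, zero_add, movesWord_cons, mX_zero, mY_zero, mL_cons_zero] at hj ⊢
      rw [vtx_append_left _ _ (by rw [length_moveWord]; omega)]
      exact vtx_moveWord m hj
    | succ k =>
      rw [mL_cons_succ] at hj
      simp only [mstart_cons_succ, movesWord_cons, mX_cons_succ, mY_cons_succ, mL_cons_succ]
      rw [show m.1.natAbs + 1 + mstart ms k + j = (moveWord m).length + (mstart ms k + j) by
        rw [length_moveWord]; ring, vtx_append_add]
      obtain ⟨e0, e1⟩ := ih (by simpa using hk) hj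
      simp only [Pi.add_apply, e0, e1, (sum_moveWord m).1, (sum_moveWord m).2]
      exact ⟨by ring, trivial⟩

/-- The vertex at the start of move `k` (or at the end). [folklore] -/
theorem vtx_mstart {k : ℕ} (hk : k ≤ ms.length) :
    vtx (movesWord ms) (mstart ms k) 0 = mX ms k ∧ vtx (movesWord ms) (mstart ms k) 1 = mY ms k := by
  rcases hk.lt_or_eq with hk | rfl
  · have := vtx_movesWord ms hk (Nat.zero_le _)
    simpa using this
  · rw [← length_movesWord, vtx_length]
    exact sum_movesWord ms

/-- **Every index decomposes** as (move, offset in the run). [folklore] -/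
theorem exists_mstart_add {i : ℕ} (hi : i < (movesWord ms).length) :
    ∃ k < ms.length, ∃ j ≤ (mL ms k).natAbs, i = mstart ms k + j := by
  induction ms generalizing i with
  | nil => simp at hi
  | cons m ms ih =>
    rw [movesWord_cons, List.length_append, length_moveWord] at hi
    by_cases h : i ≤ m.1.natAbs
    · exact ⟨0, by simp, i, by simpa [mL] using h, by simp⟩
    · obtain ⟨k, hk, j, hj, he⟩ := ih (i := i - (m.1.natAbs + 1)) (by omega)
      exact ⟨k + 1, by simpa using hk, j, by simpa [mL] using hj, by rw [mstart_cons_succ]; omega⟩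

end Moves

/-! ### Self-avoidance of a move word = disjointness of the closed runs on each line -/

section SelfAvoiding

variable (ms : List Move)

/-- Two closed integer runs `[X, X+ℓ]`, `[X', X'+ℓ']` (in either direction) are disjoint.
[folklore] -/
def RunsDisjoint (X ℓ X' ℓ' : ℤ) : Prop :=
  max X (X + ℓ) < min X' (X' + ℓ') ∨ max X' (X' + ℓ') < min X (X + ℓ)

/-- Disjointness of runs is decidable. [folklore] -/
instance (X ℓ X' ℓ' : ℤ) : Decidable (RunsDisjoint X ℓ X' ℓ') := by
  unfold RunsDisjoint; infer_instance

/-- The `j`-th column of a run lies in the closed run. [folklore] -/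
theorem col_mem_run (X ℓ : ℤ) {j : ℕ} (hj : j ≤ ℓ.natAbs) :
    min X (X + ℓ) ≤ X + msgn ℓ * j ∧ X + msgn ℓ * j ≤ max X (X + ℓ) := by
  rcases msgn_cases ℓ with ⟨h, e⟩ | ⟨h, e⟩ <;> rw [e] <;> constructor <;> omega

/-- Every column of the closed run is the `j`-th column for some `j ≤ |ℓ|`. [folklore] -/
theorem exists_col_eq {X ℓ c : ℤ} (h1 : min X (X + ℓ) ≤ c) (h2 : c ≤ max X (X + ℓ)) :
    ∃ j : ℕ, j ≤ ℓ.natAbs ∧ c = X + msgn ℓ * j := by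
  refine ⟨(c - X).natAbs, ?_, ?_⟩ <;> rcases msgn_cases ℓ with ⟨h, e⟩ | ⟨h, e⟩ <;> (try rw [e]) <;> omega

/-- **Self-avoidance from disjoint runs**: if any two moves running at the same height have
disjoint closed runs, the move word is self-avoiding. [folklore] -/
theorem injOn_movesWord
    (h : ∀ k k', k < k' → k' < ms.length → mY ms k = mY ms k' →
      RunsDisjoint (mX ms k) (mL ms k) (mX ms k') (mL ms k')) :
    Set.InjOn (vtx (movesWord ms)) (Set.Iio (movesWord ms).length) := by
  intro i hi i' hi' he
  simp only [Set.mem_Iio] at hi hi'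
  obtain ⟨k, hk, j, hj, rfl⟩ := exists_mstart_add ms hi
  obtain ⟨k', hk', j', hj', rfl⟩ := exists_mstart_add ms hi'
  obtain ⟨e0, e1⟩ := vtx_movesWord ms hk hj
  obtain ⟨e0', e1'⟩ := vtx_movesWord ms hk' hj'
  have hx : mX ms k + msgn (mL ms k) * j = mX ms k' + msgn (mL ms k') * j' := by
    rw [← e0, ← e0', he]
  have hy : mY ms k = mY ms k' := by rw [← e1, ← e1', he]
  have m1 := col_mem_run (mX ms k) (mL ms k) hj
  have m2 := col_mem_run (mX ms k') (mL ms k') hj'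
  rcases lt_trichotomy k k' with hlt | rfl | hlt
  · have hd := h k k' hlt hk' hy
    unfold RunsDisjoint at hd
    omega
  · rcases msgn_cases (mL ms k) with ⟨-, e⟩ | ⟨-, e⟩ <;> rw [e] at hx <;> omega
  · have hd := h k' k hlt hk hy.symm
    unfold RunsDisjoint at hd
    omega

/-- **Disjoint runs from self-avoidance**: conversely, in a self-avoiding move word two moves at
the same height have disjoint closed runs. [folklore] -/
theorem runsDisjoint_of_injOn (hinj : Set.InjOn (vtx (movesWord ms)) (Set.Iio (movesWord ms).length))
    {k k' : ℕ} (hkk' : k < k') (hk' : k' < ms.length) (hy : mY ms k = mY ms k') :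
    RunsDisjoint (mX ms k) (mL ms k) (mX ms k') (mL ms k') := by
  by_contra hd
  unfold RunsDisjoint at hd
  rw [not_or, not_lt, not_lt] at hd
  -- a common column `c`
  obtain ⟨c, hc1, hc2, hc3, hc4⟩ : ∃ c, min (mX ms k) (mX ms k + mL ms k) ≤ c ∧
      c ≤ max (mX ms k) (mX ms k + mL ms k) ∧ min (mX ms k') (mX ms k' + mL ms k') ≤ c ∧
      c ≤ max (mX ms k') (mX ms k' + mL ms k') :=
    ⟨max (min (mX ms k) (mX ms k + mL ms k)) (min (mX ms k') (mX ms k' + mL ms k')),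
      le_max_left _ _, by omega, le_max_right _ _, by omega⟩
  obtain ⟨j, hj, hcj⟩ := exists_col_eq hc1 hc2
  obtain ⟨j', hj', hcj'⟩ := exists_col_eq hc3 hc4
  have hk : k < ms.length := by omega
  obtain ⟨e0, e1⟩ := vtx_movesWord ms hk hj
  obtain ⟨e0', e1'⟩ := vtx_movesWord ms hk' hj'
  have hlen := length_movesWord ms
  have hlt1 := mstart_add_natAbs_lt ms hkk' hk'.le
  have hlt2 := mstart_add_natAbs_lt ms hk' le_rfl
  have heq : vtx (movesWord ms) (mstart ms k + j) = vtx (movesWord ms) (mstart ms k' + j') := by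
    refine site_eq_iff.mpr ⟨?_, ?_⟩
    · rw [e0, e0', ← hcj, ← hcj']
    · rw [e1, e1', hy]
  have := hinj (show mstart ms k + j ∈ Set.Iio (movesWord ms).length by
      simp only [Set.mem_Iio]; omega)
    (show mstart ms k' + j' ∈ Set.Iio (movesWord ms).length by simp only [Set.mem_Iio]; omega) heq
  omega

end SelfAvoiding

/-! ### Horizontal steps on a line and vertical bonds of a row, move by move -/

section Counts

/-- `Σ_{k : Y_k = y} |ℓ_k|`: the horizontal steps of the moves running at height `y`. [folklore] -/
def hstepsAt : List Move → ℤ → ℕ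
  | [], _ => 0
  | m :: ms, y => (if y = 0 then m.1.natAbs else 0) + hstepsAt ms (y - mdy m.2)

/-- The number of moves whose vertical letter crosses the cell row `r` (relative to the start):
an up-letter at height `Y` crosses row `Y`, a down-letter crosses row `Y - 1`. [folklore] -/
def crossCount : List Bool → ℤ → ℕ
  | [], _ => 0
  | u :: us, r => (if (u = true ∧ r = 0) ∨ (u = false ∧ r = -1) then 1 else 0) + crossCount us (r - mdy u)

variable (ms : List Move)

open Classical in
/-- Vertices of a move word one step apart, first part (inside the run). [folklore] -/
theorem vtx_moveWord_one (m : Move) {i : ℕ} (hi : i ≤ m.1.natAbs) : vtx (moveWord m) i 1 = 0 :=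
  (vtx_moveWord m hi).2

/-- The last vertex of a move word is one up or down. [folklore] -/
theorem vtx_moveWord_length_one (m : Move) : vtx (moveWord m) (m.1.natAbs + 1) 1 = mdy m.2 := by
  rw [show m.1.natAbs + 1 = (moveWord m).length by rw [length_moveWord], vtx_length,
    (sum_moveWord m).2]

open Classical in
/-- **Horizontal steps on a line**: the steps of `movesWord ms` with both ends at height `y` are
the `Σ_{k : Y_k = y} |ℓ_k|` letters of the runs at height `y`. [folklore] -/
theorem card_hsteps_movesWord (y : ℤ) :
    ((Finset.range (movesWord ms).length).filter fun i =>
        vtx (movesWord ms) i 1 = y ∧ vtx (movesWord ms) (i + 1) 1 = y).card = hstepsAt ms y := by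
  induction ms generalizing y with
  | nil => simp [hstepsAt]
  | cons m ms ih =>
    rw [movesWord_cons, List.length_append, length_moveWord, card_filter_range_add, hstepsAt]
    congr 1
    · -- inside the first move: `|ℓ|` horizontal steps at height `0`, then a vertical one
      rw [Finset.range_add_one, Finset.filter_insert]
      have hlast : ¬ (vtx (moveWord m ++ movesWord ms) m.1.natAbs 1 = y ∧
          vtx (moveWord m ++ movesWord ms) (m.1.natAbs + 1) 1 = y) := by
        rw [vtx_append_left _ _ (by rw [length_moveWord]; omega),
          vtx_append_left _ _ (by rw [length_moveWord]), vtx_moveWord_one m le_rfl,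
          vtx_moveWord_length_one]
        rcases mdy_cases m.2 with ⟨-, e⟩ | ⟨-, e⟩ <;> rw [e] <;> omega
      rw [if_neg hlast]
      by_cases hy : y = 0
      · subst hy
        rw [if_pos rfl, Finset.filter_true_of_mem, Finset.card_range]
        intro i hi
        rw [Finset.mem_range] at hi
        rw [vtx_append_left _ _ (by rw [length_moveWord]; omega),
          vtx_append_left _ _ (by rw [length_moveWord]; omega), vtx_moveWord_one m hi.le,
          vtx_moveWord_one m hi]
        exact ⟨rfl, rfl⟩
      · rw [if_neg hy, Finset.card_eq_zero, Finset.filter_eq_empty_iff]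
        intro i hi
        rw [Finset.mem_range] at hi
        rw [vtx_append_left _ _ (by rw [length_moveWord]; omega), vtx_moveWord_one m hi.le]
        exact fun h => hy h.1.symm
    · -- the other moves, shifted by `mdy`
      rw [← ih (y - mdy m.2)]
      refine card_filter_congr' fun i _ => ?_
      rw [show m.1.natAbs + 1 + i = (moveWord m).length + i by rw [length_moveWord],
        show (moveWord m).length + i + 1 = (moveWord m).length + (i + 1) by ring,
        vtx_append_add, vtx_append_add, Pi.add_apply, Pi.add_apply, (sum_moveWord m).2]
      constructor <;> rintro ⟨h1, h2⟩ <;> constructor <;> omega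

open Classical in
/-- **Vertical bonds of a row**: the steps of `movesWord ms` crossing the cell row `r` are the
vertical letters of the moves crossing it. [folklore] -/
theorem card_cross_movesWord (r : ℤ) :
    ((Finset.range (movesWord ms).length).filter fun i =>
        IsCross r (vtx (movesWord ms) i 1) (vtx (movesWord ms) (i + 1) 1)).card =
      crossCount (ms.map Prod.snd) r := by
  induction ms generalizing r with
  | nil => simp [crossCount]
  | cons m ms ih =>
    rw [movesWord_cons, List.length_append, length_moveWord, card_filter_range_add, List.map_cons,
      crossCount]
    congr 1
    · rw [Finset.range_add_one, Finset.filter_insert]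
      have hin : ∀ i < m.1.natAbs, ¬ IsCross r (vtx (moveWord m ++ movesWord ms) i 1)
          (vtx (moveWord m ++ movesWord ms) (i + 1) 1) := by
        intro i hi
        rw [vtx_append_left _ _ (by rw [length_moveWord]; omega),
          vtx_append_left _ _ (by rw [length_moveWord]; omega), vtx_moveWord_one m hi.le,
          vtx_moveWord_one m hi, IsCross]
        omega
      have hrest : ((Finset.range m.1.natAbs).filter fun i => IsCross r
          (vtx (moveWord m ++ movesWord ms) i 1) (vtx (moveWord m ++ movesWord ms) (i + 1) 1)).card = 0 := by
        rw [Finset.card_eq_zero, Finset.filter_eq_empty_iff]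
        intro i hi
        exact hin i (Finset.mem_range.mp hi)
      have hlast : IsCross r (vtx (moveWord m ++ movesWord ms) m.1.natAbs 1)
          (vtx (moveWord m ++ movesWord ms) (m.1.natAbs + 1) 1) ↔
          (m.2 = true ∧ r = 0) ∨ (m.2 = false ∧ r = -1) := by
        rw [vtx_append_left _ _ (by rw [length_moveWord]; omega),
          vtx_append_left _ _ (by rw [length_moveWord]), vtx_moveWord_one m le_rfl,
          vtx_moveWord_length_one, IsCross]
        rcases mdy_cases m.2 with ⟨hu, e⟩ | ⟨hu, e⟩ <;> rw [e, hu] <;> simp <;> omega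
      by_cases hc : (m.2 = true ∧ r = 0) ∨ (m.2 = false ∧ r = -1)
      · rw [if_pos (hlast.mpr hc), if_pos hc, Finset.card_insert_of_notMem (by simp), hrest]
      · rw [if_neg (fun h => hc (hlast.mp h)), if_neg hc, hrest]
    · rw [← ih (r - mdy m.2)]
      refine card_filter_congr' fun i _ => ?_
      rw [show m.1.natAbs + 1 + i = (moveWord m).length + i by rw [length_moveWord],
        show (moveWord m).length + i + 1 = (moveWord m).length + (i + 1) by ring,
        vtx_append_add, vtx_append_add, Pi.add_apply, Pi.add_apply, (sum_moveWord m).2, IsCross,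
        IsCross]
      omega

end Counts

/-! ### Reading the moves off a word -/

section MovesOf

/-- Read the moves of a word: accumulate the signed length of the current run, emit a move at
each vertical letter (a trailing run without vertical letter is dropped). [folklore] -/
def movesOfAux : List (Fin 4) → ℤ → List Move
  | [], _ => []
  | a :: w, ℓ => if a = 0 then movesOfAux w (ℓ + 1) else if a = 1 then movesOfAux w (ℓ - 1)
      else (ℓ, decide (a = 2)) :: movesOfAux w 0

/-- The moves of a word. [folklore] -/
def movesOf (W : List (Fin 4)) : List Move := movesOfAux W 0

/-- Straight runs: two consecutive horizontal letters coincide (true for self-avoiding words,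
`IsSAP.getElem_eq_of_horizontal`). [folklore] -/
def Pure (W : List (Fin 4)) : Prop :=
  ∀ i : ℕ, (h : i + 1 < W.length) → (W[i]).val < 2 → (W[i + 1]).val < 2 → W[i] = W[i + 1]

variable {W : List (Fin 4)}

/-- A self-avoiding word has straight runs. [folklore] -/
theorem IsSAP.pure (h : IsSAP W) : Pure W := fun _ hi h1 h2 => h.getElem_eq_of_horizontal hi h1 h2

/-- The tail of a word with straight runs has straight runs. [folklore] -/
theorem Pure.tail {a : Fin 4} (h : Pure (a :: W)) : Pure W := by
  intro i hi h1 h2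
  have := h (i + 1) (by simpa using hi) (by simpa using h1) (by simpa using h2)
  simpa using this

/-- After a horizontal letter, the next letter, if horizontal, is the same. [folklore] -/
theorem Pure.head_eq {a b : Fin 4} {W : List (Fin 4)} (h : Pure (a :: b :: W)) (ha : a.val < 2)
    (hb : b.val < 2) : a = b := by
  have := h 0 (by simp) (by simpa using ha) (by simpa using hb)
  simpa using this

/-- `vletter` inverts `decide (a = 2)` on vertical letters. [folklore] -/
theorem vletter_decide {a : Fin 4} (ha : 2 ≤ a.val) : vletter (decide (a = 2)) = a := by
  have : a = 2 ∨ a = 3 := by omega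
  rcases this with rfl | rfl <;> rfl

/-- Reading the empty word. [folklore] -/
@[simp] theorem movesOfAux_nil (ℓ : ℤ) : movesOfAux [] ℓ = [] := rfl

/-- Reading an `E`. [folklore] -/
theorem movesOfAux_cons_zero (W : List (Fin 4)) (ℓ : ℤ) : movesOfAux (0 :: W) ℓ = movesOfAux W (ℓ + 1) := by
  simp [movesOfAux]

/-- Reading a `W`. [folklore] -/
theorem movesOfAux_cons_one (W : List (Fin 4)) (ℓ : ℤ) : movesOfAux (1 :: W) ℓ = movesOfAux W (ℓ - 1) := by
  simp [movesOfAux]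

/-- Reading a vertical letter. [folklore] -/
theorem movesOfAux_cons_vert {a : Fin 4} (ha : 2 ≤ a.val) (W : List (Fin 4)) (ℓ : ℤ) :
    movesOfAux (a :: W) ℓ = (ℓ, decide (a = 2)) :: movesOfAux W 0 := by
  have h0 : a ≠ 0 := fun h => by subst h; simp at ha
  have h1 : a ≠ 1 := fun h => by subst h; simp at ha
  simp [movesOfAux, h0, h1]

/-- **Round trip** (with an accumulated run of signed length `ℓ` compatible with the first letter):
`movesWord (movesOfAux W ℓ) = (run of ℓ) ++ W` for a word with straight runs ending vertically.
[folklore] -/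
theorem movesWord_movesOfAux (hp : Pure W) (hlast : ∃ a, W.getLast? = some a ∧ 2 ≤ a.val) (ℓ : ℤ)
    (hcompat : ∀ a, W.head? = some a → a.val < 2 → ℓ ≠ 0 → a = hletter ℓ) :
    movesWord (movesOfAux W ℓ) = List.replicate ℓ.natAbs (hletter ℓ) ++ W := by
  induction W generalizing ℓ with
  | nil => obtain ⟨a, ha, -⟩ := hlast; simp at ha
  | cons a W ih =>
    obtain ⟨z, hz, hz2⟩ := hlast
    by_cases hW : W = []
    · subst hW
      simp only [List.getLast?_singleton, Option.some.injEq] at hz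
      subst hz
      rw [movesOfAux_cons_vert hz2, movesWord_cons, movesOfAux_nil, movesWord_nil, List.append_nil,
        moveWord, vletter_decide hz2]
    · have hlast' : ∃ a, W.getLast? = some a ∧ 2 ≤ a.val := by
        refine ⟨z, ?_, hz2⟩
        rwa [List.getLast?_cons_of_ne_nil hW] at hz
      obtain ⟨b, W', rfl⟩ : ∃ b W', W = b :: W' := by
        cases W with
        | nil => exact absurd rfl hW
        | cons b W' => exact ⟨b, W', rfl⟩
      by_cases ha0 : a = 0
      · subst ha0
        have hℓ : 0 ≤ ℓ := by
          by_cases h0 : ℓ = 0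
          · omega
          · have := hcompat 0 rfl (by decide) h0
            unfold hletter at this; split_ifs at this with h
            · exact h
            · exact absurd this (by decide)
        rw [movesOfAux_cons_zero, ih hp.tail hlast' (ℓ + 1)]
        · have e1 : hletter (ℓ + 1) = 0 := by unfold hletter; rw [if_pos (by omega)]
          have e2 : hletter ℓ = 0 := by unfold hletter; rw [if_pos hℓ]
          rw [e1, e2, show (ℓ + 1).natAbs = ℓ.natAbs + 1 by omega, List.replicate_succ',
            List.append_assoc]
          rfl
        · intro c hc hc2 _
          simp only [List.head?_cons, Option.some.injEq] at hc
          subst hc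
          rw [← hp.head_eq (by decide) hc2]
          unfold hletter; rw [if_pos (by omega)]
      by_cases ha1 : a = 1
      · subst ha1
        have hℓ : ℓ ≤ 0 := by
          by_cases h0 : ℓ = 0
          · omega
          · have := hcompat 1 rfl (by decide) h0
            unfold hletter at this; split_ifs at this with h
            · exact absurd this (by decide)
            · omega
        rw [movesOfAux_cons_one, ih hp.tail hlast' (ℓ - 1)]
        · have e1 : hletter (ℓ - 1) = 1 := by unfold hletter; rw [if_neg (by omega)]
          rw [e1, show (ℓ - 1).natAbs = ℓ.natAbs + 1 by omega, List.replicate_succ', List.append_assoc]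
          rcases eq_or_ne ℓ 0 with rfl | hne
          · rfl
          · have e2 : hletter ℓ = 1 := by unfold hletter; rw [if_neg (by omega)]
            rw [e2]; rfl
        · intro c hc hc2 _
          simp only [List.head?_cons, Option.some.injEq] at hc
          subst hc
          rw [← hp.head_eq (by decide) hc2]
          unfold hletter; rw [if_neg (by omega)]
      · -- a vertical letter closes the move
        have ha2 : 2 ≤ a.val := by
          have : a.val ≠ 0 := fun h => ha0 (Fin.ext h)
          have : a.val ≠ 1 := fun h => ha1 (Fin.ext h)
          omega
        rw [movesOfAux_cons_vert ha2, movesWord_cons, ih hp.tail hlast' 0 (fun _ _ _ h => absurd rfl h)]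
        simp [moveWord, vletter_decide ha2]

/-- **A word with straight runs ending with a vertical letter is the word of its moves.**
[folklore] -/
theorem movesWord_movesOf (hp : Pure W) (hlast : ∃ a, W.getLast? = some a ∧ 2 ≤ a.val) :
    movesWord (movesOf W) = W := by
  rw [movesOf, movesWord_movesOfAux hp hlast 0 (fun _ _ _ h => absurd rfl h)]
  simp

/-- A canonical SAP word is the word of its moves. [folklore] -/
theorem IsCanon.movesWord_movesOf (h : IsCanon W) : movesWord (movesOf W) = W :=
  Haruspicy.movesWord_movesOf h.1.pure ⟨3, h.getLast?, by decide⟩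

/-- Reading a run: `movesOfAux (a^n ++ V) ℓ = movesOfAux V (ℓ ± n)`. [folklore] -/
theorem movesOfAux_replicate_append (n : ℕ) (ℓ c : ℤ) (V : List (Fin 4)) :
    movesOfAux (List.replicate n (hletter ℓ) ++ V) c = movesOfAux V (c + msgn ℓ * n) := by
  induction n generalizing c with
  | zero => simp
  | succ n ih =>
    rw [List.replicate_succ, List.cons_append]
    rcases msgn_cases ℓ with ⟨h, e⟩ | ⟨h, e⟩
    · have : hletter ℓ = 0 := by unfold hletter; rw [if_pos h]
      rw [this] at ih ⊢
      simp only [movesOfAux, ↓reduceIte]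
      rw [ih, e]; congr 1; push_cast; ring
    · have : hletter ℓ = 1 := by unfold hletter; rw [if_neg (by omega)]
      rw [this] at ih ⊢
      simp only [movesOfAux, show (1 : Fin 4) ≠ 0 by decide, ↓reduceIte]
      rw [ih, e]; congr 1; push_cast; ring

/-- **The moves of a move word are the moves.** [folklore] -/
theorem movesOf_movesWord (ms : List Move) : movesOf (movesWord ms) = ms := by
  suffices h : ∀ V, movesOfAux (movesWord ms ++ V) 0 = ms ++ movesOfAux V 0 by
    simpa [movesOf, movesOfAux_nil] using h []
  induction ms with
  | nil => intro V; rfl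
  | cons m ms ih =>
    intro V
    rw [movesWord_cons, List.append_assoc, moveWord, List.append_assoc, movesOfAux_replicate_append,
      zero_add, msgn_mul_natAbs, List.singleton_append]
    have h0 : vletter m.2 ≠ 0 := by cases m.2 <;> decide
    have h1 : vletter m.2 ≠ 1 := by cases m.2 <;> decide
    have h2 : decide (vletter m.2 = 2) = m.2 := by cases m.2 <;> decide
    simp only [movesOfAux, if_neg h0, if_neg h1, h2, ih, List.cons_append]

end MovesOf

/-! ### Heights of a move list depend on the up/down pattern only -/

section Heights

/-- The height function of an up/down pattern (`Σ_{i<k} ±1`). [folklore] -/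
def htB : List Bool → ℕ → ℤ
  | _, 0 => 0
  | [], _ + 1 => 0
  | u :: us, k + 1 => mdy u + htB us k

/-- `mY` is `htB` of the pattern. [folklore] -/
theorem mY_eq_htB (ms : List Move) (k : ℕ) : mY ms k = htB (ms.map Prod.snd) k := by
  induction ms generalizing k with
  | nil => cases k <;> rfl
  | cons m ms ih => cases k with
    | zero => rfl
    | succ k => rw [mY_cons_succ, List.map_cons, htB, ih]

/-- The first letter of a move word whose first run is a non-empty `E`-run is `E`. [folklore] -/
theorem head?_movesWord_of_pos {m : Move} (hm : 1 ≤ m.1) (ms : List Move) :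
    (movesWord (m :: ms)).head? = some 0 := by
  rw [movesWord_cons, moveWord, show m.1.natAbs = (m.1.natAbs - 1) + 1 by omega, List.replicate_succ]
  simp only [List.cons_append, List.head?_cons, Option.some.injEq]
  unfold hletter; rw [if_pos (by omega)]

/-- The first letter of a move word determines the sign of the first run: if it is `E`, the first
run is a non-empty `E`-run. [folklore] -/
theorem one_le_of_head? {m : Move} {ms : List Move} (h : (movesWord (m :: ms)).head? = some 0) : 1 ≤ m.1 := by
  by_contra hlt
  rw [movesWord_cons, moveWord] at h
  rcases eq_or_ne m.1 0 with h0 | h0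
  · rw [h0] at h
    simp only [Int.natAbs_zero, List.replicate_zero, List.nil_append, List.cons_append,
      List.head?_cons, Option.some.injEq] at h
    revert h; cases m.2 <;> decide
  · rw [show m.1.natAbs = (m.1.natAbs - 1) + 1 by omega, List.replicate_succ] at h
    simp only [List.cons_append, List.head?_cons, Option.some.injEq] at h
    unfold hletter at h; rw [if_neg (by omega)] at h
    exact absurd h (by decide)

end Heights

/-! ### Building blocks: eight moves of shape `A` (`NNNSSNSS`) or `B` (`NNSNNSSS`) -/

section BuildingBlocks

/-- The eight moves of a candidate building block of shape `A` (`isA = true`, up/down pattern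
`NNNSSNSS`, runs at heights `0,1,2,3,2,1,2,1`) or `B` (`NNSNNSSS`, heights `0,1,2,1,2,3,2,1`)
with signed run lengths `ℓ`. [cite: Rechnitzer2006Haruspicy2, Lemma 21 and Figure 11] -/
def bbMoves (isA : Bool) (ℓ : Fin 8 → ℤ) : List Move :=
  if isA then [(ℓ 0, true), (ℓ 1, true), (ℓ 2, true), (ℓ 3, false), (ℓ 4, false), (ℓ 5, true),
    (ℓ 6, false), (ℓ 7, false)]
  else [(ℓ 0, true), (ℓ 1, true), (ℓ 2, false), (ℓ 3, true), (ℓ 4, true), (ℓ 5, false),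
    (ℓ 6, false), (ℓ 7, false)]

/-- The index of the top run (the move at height `3`). [cite: Rechnitzer2006Haruspicy2, Lemma 21] -/
def bbTop (isA : Bool) : Fin 8 := if isA then 3 else 5

/-- The heights of the eight runs (and the final height `0`). [cite: Rechnitzer2006Haruspicy2, Lemma 21] -/
def bbHt (isA : Bool) (k : ℕ) : ℤ :=
  if isA then (([0, 1, 2, 3, 2, 1, 2, 1, 0] : List ℤ).getD k 0) else (([0, 1, 2, 1, 2, 3, 2, 1, 0] : List ℤ).getD k 0)

variable {isA : Bool} {ℓ : Fin 8 → ℤ}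

/-- Eight moves. [folklore] -/
@[simp] theorem length_bbMoves (isA : Bool) (ℓ : Fin 8 → ℤ) : (bbMoves isA ℓ).length = 8 := by
  cases isA <;> rfl

/-- The run lengths of `bbMoves`. [folklore] -/
theorem mL_bbMoves (isA : Bool) (ℓ : Fin 8 → ℤ) (k : Fin 8) : mL (bbMoves isA ℓ) k = ℓ k := by
  cases isA <;> fin_cases k <;> rfl

/-- The up/down pattern of `bbMoves`. [folklore] -/
theorem map_snd_bbMoves (isA : Bool) (ℓ : Fin 8 → ℤ) : (bbMoves isA ℓ).map Prod.snd =
    if isA then [true, true, true, false, false, true, false, false]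
    else [true, true, false, true, true, false, false, false] := by
  cases isA <;> rfl

/-- The heights of `bbMoves`. [folklore] -/
theorem mY_bbMoves (isA : Bool) (ℓ : Fin 8 → ℤ) {k : ℕ} (hk : k ≤ 8) : mY (bbMoves isA ℓ) k = bbHt isA k := by
  interval_cases k <;> cases isA <;> simp [bbMoves, bbHt, mY, mdy]

/-- The heights are in `[0, 3]`, positive except at the two ends. [folklore] -/
theorem bbHt_bounds (isA : Bool) {k : ℕ} (hk : k ≤ 8) :
    0 ≤ bbHt isA k ∧ bbHt isA k ≤ 3 ∧ (1 ≤ k → k ≤ 7 → 1 ≤ bbHt isA k) ∧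
      (bbHt isA k = 3 ↔ k = bbTop isA) ∧ (k ≤ 7 → (bbHt isA k = 0 ↔ k = 0)) := by
  interval_cases k <;> cases isA <;> simp [bbHt, bbTop]

/-- The columns of `bbMoves`: `X_k = Σ_{i<k} ℓ_i`. [folklore] -/
theorem mX_bbMoves (isA : Bool) (ℓ : Fin 8 → ℤ) {k : ℕ} (hk : k ≤ 8) :
    mX (bbMoves isA ℓ) k = ∑ i : Fin 8, if (i : ℕ) < k then ℓ i else 0 := by
  interval_cases k <;> cases isA <;> simp [bbMoves, mX, Fin.sum_univ_eight, add_assoc]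

/-- The horizontal letters of `bbMoves`: `Σ |ℓ_k|`. [folklore] -/
theorem mh_bbMoves (isA : Bool) (ℓ : Fin 8 → ℤ) : mh (bbMoves isA ℓ) = ∑ i : Fin 8, (ℓ i).natAbs := by
  cases isA <;> simp [bbMoves, mh, Fin.sum_univ_eight, add_assoc]

/-- `bbMoves` determines the shape and the run lengths. [folklore] -/
theorem bbMoves_injective {isA isA' : Bool} {ℓ ℓ' : Fin 8 → ℤ} (h : bbMoves isA ℓ = bbMoves isA' ℓ') :
    isA = isA' ∧ ℓ = ℓ' := by
  cases isA <;> cases isA' <;>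
    simp only [bbMoves, Bool.false_eq_true, ↓reduceIte, List.cons.injEq, Prod.mk.injEq, and_true,
      Bool.true_eq_false, Bool.false_eq_true, and_false, false_and, true_and] at h ⊢ <;>
    · obtain ⟨h0, h1, h2, h3, h4, h5, h6, h7⟩ := h
      funext k; fin_cases k <;> assumption

/-- **Valid building-block data**: closure `Σ ℓ_k = 0`, a non-empty bottom row `ℓ₀ ≥ 1` read
eastwards, and the closed runs at equal heights pairwise disjoint (self-avoidance).
[cite: Rechnitzer2006Haruspicy2, Lemma 21] -/
structure BBValid (isA : Bool) (ℓ : Fin 8 → ℤ) : Prop where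
  /-- closure: the runs sum to zero -/
  sum : ∑ i : Fin 8, ℓ i = 0
  /-- the bottom row is a non-empty `E`-run -/
  pos : 1 ≤ ℓ 0
  /-- runs at the same height are disjoint -/
  disj : ∀ k k' : ℕ, k < k' → k' < 8 → mY (bbMoves isA ℓ) k = mY (bbMoves isA ℓ) k' →
    RunsDisjoint (mX (bbMoves isA ℓ) k) (mL (bbMoves isA ℓ) k) (mX (bbMoves isA ℓ) k') (mL (bbMoves isA ℓ) k')

/-- All heights of the word of `bbMoves` are `≤ 3`. [folklore] -/
theorem vtx_bbMoves_one_le_three (isA : Bool) (ℓ : Fin 8 → ℤ) {i : ℕ}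
    (hi : i < (movesWord (bbMoves isA ℓ)).length) : vtx (movesWord (bbMoves isA ℓ)) i 1 ≤ 3 := by
  obtain ⟨k, hk, j, hj, rfl⟩ := exists_mstart_add _ hi
  rw [length_bbMoves] at hk
  rw [(vtx_movesWord _ (by simpa using hk) hj).2, mY_bbMoves _ _ hk.le]
  exact (bbHt_bounds isA hk.le).2.1

namespace BBValid

variable (h : BBValid isA ℓ)
include h

/-- The word of valid building-block data is a canonical SAP word. [cite: Rechnitzer2006Haruspicy2, Lemma 21] -/
theorem isCanon : IsCanon (movesWord (bbMoves isA ℓ)) := by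
  have hlen := length_movesWord_eq_mh (bbMoves isA ℓ)
  rw [length_bbMoves] at hlen
  refine ⟨⟨by omega, ?_, ?_⟩, ?_, ?_⟩
  · -- closed
    obtain ⟨s0, s1⟩ := sum_movesWord (bbMoves isA ℓ)
    rw [length_bbMoves] at s0 s1
    refine site_eq_iff.mpr ⟨?_, ?_⟩
    · rw [s0, mX_bbMoves _ _ le_rfl]
      simp only [Fin.is_lt, ↓reduceIte, h.sum, Pi.zero_apply]
    · rw [s1, mY_bbMoves _ _ le_rfl]
      cases isA <;> rfl
  · -- self-avoiding
    exact injOn_movesWord _ fun k k' hkk' hk' hy => h.disj k k' hkk' (by simpa using hk') hy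
  · -- rooted at the least vertex
    intro i hi
    obtain ⟨k, hk, j, hj, rfl⟩ := exists_mstart_add _ hi
    rw [length_bbMoves] at hk
    obtain ⟨e0, e1⟩ := vtx_movesWord _ (by simpa using hk) hj
    rw [key_le_key, e0, e1, mY_bbMoves _ _ hk.le]
    simp only [Pi.zero_apply]
    obtain ⟨b0, -, b1, -, b4⟩ := bbHt_bounds isA hk.le
    rcases Nat.eq_zero_or_pos k with rfl | hpos
    · right
      refine ⟨by cases isA <;> rfl, ?_⟩
      rw [mX_zero, show mL (bbMoves isA ℓ) 0 = ℓ 0 from mL_bbMoves isA ℓ 0]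
      have : msgn (ℓ 0) = 1 := by unfold msgn; rw [if_pos (by linarith [h.pos])]
      rw [this]; positivity
    · left; have := b1 hpos (by omega); omega
  · -- first letter `E`
    have hp := h.pos
    cases isA <;> exact head?_movesWord_of_pos hp _

/-- The highest line is `y = 3`. [cite: Rechnitzer2006Haruspicy2, Lemma 21] -/
theorem yMax_eq : yMax (bonds (movesWord (bbMoves isA ℓ))) = 3 := by
  have hlen := length_movesWord_eq_mh (bbMoves isA ℓ)
  rw [length_bbMoves] at hlen
  have htop : mstart (bbMoves isA ℓ) (bbTop isA) < (movesWord (bbMoves isA ℓ)).length := by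
    rw [length_movesWord, length_bbMoves]
    exact (Nat.le_add_right _ _).trans_lt (mstart_add_natAbs_lt (bbMoves isA ℓ) (k := bbTop isA)
      (k' := 8) (by cases isA <;> decide) (by simp))
  refine yMax_bonds_eq (by norm_num) (fun i hi => vtx_bbMoves_one_le_three isA ℓ hi) htop ?_
  rw [(vtx_mstart _ (by rw [length_bbMoves]; exact (bbTop isA).isLt.le)).2,
    mY_bbMoves _ _ (by cases isA <;> decide)]
  cases isA <;> rfl

open Classical in
/-- The top row has `|ℓ_top|` horizontal bonds. [cite: Rechnitzer2006Haruspicy2, Lemma 21] -/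
theorem topWidth_eq : topWidth (bonds (movesWord (bbMoves isA ℓ))) = (ℓ (bbTop isA)).natAbs := by
  rw [topWidth_bonds, h.yMax_eq, card_hsteps_movesWord]
  cases isA <;> simp [bbMoves, hstepsAt, mdy, bbTop]

open Classical in
/-- The bottom row has `ℓ₀` horizontal bonds. [cite: Rechnitzer2006Haruspicy2, Lemma 21] -/
theorem bottomWidth_eq : bottomWidth (bonds (movesWord (bbMoves isA ℓ))) = (ℓ 0).natAbs := by
  rw [bottomWidth_bonds, h.isCanon.2.1.yMin_bonds, card_hsteps_movesWord]
  cases isA <;> simp [bbMoves, hstepsAt, mdy]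

open Classical in
/-- The rows carry `2, 4, 2` vertical bonds: the word is a 2-4-2 word with `k = 2`.
[cite: Rechnitzer2006Haruspicy2, Definition 18 and Lemma 21] -/
theorem is242 : Is242 2 (bonds (movesWord (bbMoves isA ℓ))) := by
  rw [h.isCanon.is242_iff, h.yMax_eq]
  refine ⟨by norm_num, fun i hi => ?_⟩
  rw [rowVerticalBonds_bonds, card_cross_movesWord, map_snd_bbMoves]
  have hi3 : i < 3 := by omega
  interval_cases i <;> cases isA <;> decide

/-- **Valid building-block data give building-block words** with bottom row `w = ℓ₀`, top row
`t = |ℓ_top|` and horizontal half-perimeter `M = Σ|ℓ_k|/2`. [cite: Rechnitzer2006Haruspicy2, Lemma 21] -/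
theorem mem_bbWords {M t w : ℕ} (hM : ∑ i : Fin 8, (ℓ i).natAbs = 2 * M) (ht : (ℓ (bbTop isA)).natAbs = t)
    (hw : ℓ 0 = w) : movesWord (bbMoves isA ℓ) ∈ bbWords M t w := by
  have hlen := length_movesWord_eq_mh (bbMoves isA ℓ)
  rw [length_bbMoves, mh_bbMoves, hM] at hlen
  rw [Haruspicy.mem_bbWords]
  refine ⟨by omega, h.isCanon, by rw [hcount_movesWord, mh_bbMoves, hM], h.is242,
    by rw [h.topWidth_eq, ht], by rw [h.bottomWidth_eq, hw]; rfl⟩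

end BBValid

/-! ### Every building-block word arises this way -/

/-- The up/down patterns compatible with the 2-4-2 profile: an eight-letter pattern whose heights
stay in `[0, 3]` and return to `0`, crossing the cell rows `0, 1, 2` respectively `2, 4, 2` times,
is `NNNSSNSS` or `NNSNNSSS` (a finite check). [cite: Rechnitzer2006Haruspicy2, Lemma 21] -/
theorem bb_pattern_cases (u : Fin 8 → Bool) (h8 : htB (List.ofFn u) 8 = 0)
    (h0 : crossCount (List.ofFn u) 0 = 2) (h1 : crossCount (List.ofFn u) 1 = 4)
    (h2 : crossCount (List.ofFn u) 2 = 2)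
    (hb : ∀ k ≤ 8, 0 ≤ htB (List.ofFn u) k ∧ htB (List.ofFn u) k ≤ 3) :
    List.ofFn u = [true, true, true, false, false, true, false, false] ∨
      List.ofFn u = [true, true, false, true, true, false, false, false] := by
  revert u
  decide +kernel

/-- Lists of length eight. [folklore] -/
theorem exists_eq_of_length_eight {α : Type*} {l : List α} (h : l.length = 8) :
    ∃ a0 a1 a2 a3 a4 a5 a6 a7 : α, l = [a0, a1, a2, a3, a4, a5, a6, a7] := by
  match l, h with
  | [a0, a1, a2, a3, a4, a5, a6, a7], _ => exact ⟨a0, a1, a2, a3, a4, a5, a6, a7, rfl⟩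

/-- **Classification of building-block words**: every word of `bbWords M t w` is the word of valid
building-block data of shape `A` or `B`, with `Σ|ℓ_k| = 2M`, `|ℓ_top| = t`, `ℓ₀ = w`.
[cite: Rechnitzer2006Haruspicy2, Lemma 21 and Figure 11] -/
theorem exists_bbValid_of_mem_bbWords {W : List (Fin 4)} {M t w : ℕ} (hW : W ∈ bbWords M t w) :
    ∃ (isA : Bool) (ℓ : Fin 8 → ℤ), BBValid isA ℓ ∧ movesWord (bbMoves isA ℓ) = W ∧
      ∑ i : Fin 8, (ℓ i).natAbs = 2 * M ∧ (ℓ (bbTop isA)).natAbs = t ∧ ℓ 0 = w := by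
  classical
  obtain ⟨hlen, hcanon, hhc, h242, htop, hbot⟩ := mem_bbWords.mp hW
  have hms : movesWord (movesOf W) = W := hcanon.movesWord_movesOf
  set ms := movesOf W with hms_def
  -- eight moves
  have hlen8 : ms.length = 8 := by
    have h1 := length_movesWord_eq_mh ms
    have h2 := hcount_movesWord ms
    rw [hms] at h1 h2
    omega
  obtain ⟨m0, m1, m2, m3, m4, m5, m6, m7, hms8⟩ := exists_eq_of_length_eight hlen8
  -- heights and crossings
  obtain ⟨hyMax, hrows⟩ := (hcanon.is242_iff 2).mp h242
  norm_num at hyMax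
  have hY : ∀ k ≤ 8, 0 ≤ mY ms k ∧ mY ms k ≤ 3 := by
    intro k hk
    have hle : mstart ms k ≤ W.length := by
      rw [← hms, length_movesWord]; exact mstart_mono ms (by omega) le_rfl
    rw [← (vtx_mstart ms (by omega)).2, hms]
    exact ⟨hcanon.2.1.vtx_one_nonneg' hcanon.1.2.1 hle, hyMax ▸ vtx_le_yMax hcanon.1.2.1 hle⟩
  have hY8 : mY ms 8 = 0 := by
    have := (sum_movesWord ms).2
    rw [hms, hcanon.1.2.1, hlen8] at this
    exact this.symm
  have hcross : ∀ r : ℕ, r < 3 → crossCount (ms.map Prod.snd) r = if Even r then 2 else 4 := by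
    intro r hr
    rw [← card_cross_movesWord, hms, ← rowVerticalBonds_bonds]
    exact hrows r (by omega)
  -- the pattern
  set u : Fin 8 → Bool := ![m0.2, m1.2, m2.2, m3.2, m4.2, m5.2, m6.2, m7.2] with hu
  have hpat : ms.map Prod.snd = List.ofFn u := by rw [hms8, hu]; simp [List.ofFn_succ]
  have hcases := bb_pattern_cases u (by rw [← hpat, ← mY_eq_htB]; exact hY8)
    (by have := hcross 0 (by norm_num); rw [hpat] at this; simpa using this)
    (by have := hcross 1 (by norm_num); rw [hpat] at this; simpa using this)
    (by have := hcross 2 (by norm_num); rw [hpat] at this; simpa using this)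
    (fun k hk => by rw [← hpat, ← mY_eq_htB]; exact hY k hk)
  rw [← hpat, hms8] at hcases
  simp only [List.map_cons, List.map_nil, List.cons.injEq, and_true] at hcases
  -- the data
  set ℓ : Fin 8 → ℤ := ![m0.1, m1.1, m2.1, m3.1, m4.1, m5.1, m6.1, m7.1] with hℓ
  have key : ∃ isA : Bool, bbMoves isA ℓ = ms := by
    rcases hcases with ⟨e0, e1, e2, e3, e4, e5, e6, e7⟩ | ⟨e0, e1, e2, e3, e4, e5, e6, e7⟩
    · exact ⟨true, by rw [hms8]; simp [bbMoves, hℓ, Prod.ext_iff, e0, e1, e2, e3, e4, e5, e6, e7]⟩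
    · exact ⟨false, by rw [hms8]; simp [bbMoves, hℓ, Prod.ext_iff, e0, e1, e2, e3, e4, e5, e6, e7]⟩
  obtain ⟨isA, hbb⟩ := key
  have hvalid : BBValid isA ℓ := by
    refine ⟨?_, ?_, ?_⟩
    · -- closure
      have := (sum_movesWord ms).1
      rw [hms, hcanon.1.2.1, hlen8, ← hbb, mX_bbMoves _ _ le_rfl] at this
      simpa using this.symm
    · -- first letter
      have hh := hcanon.2.2
      rw [← hms, ← hbb] at hh
      cases isA <;> simp only [bbMoves, Bool.false_eq_true, ↓reduceIte] at hh <;>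
        exact (one_le_of_head? hh :)
    · intro k k' hkk' hk' hy
      rw [hbb]
      refine runsDisjoint_of_injOn ms ?_ hkk' (by omega) (by rwa [hbb] at hy)
      rw [hms]; exact hcanon.1.2.2
  refine ⟨isA, ℓ, hvalid, by rw [hbb, hms], ?_, ?_, ?_⟩
  · have := hcount_movesWord (bbMoves isA ℓ)
    rw [mh_bbMoves, hbb, hms, hhc] at this
    exact this.symm
  · rw [← hvalid.topWidth_eq, hbb, hms, htop]
  · have e := hvalid.bottomWidth_eq
    rw [hbb, hms, hbot] at e
    have := hvalid.pos
    omega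

/-- Distinct valid data give distinct words. [folklore] -/
theorem movesWord_bbMoves_injective {isA isA' : Bool} {ℓ ℓ' : Fin 8 → ℤ}
    (h : movesWord (bbMoves isA ℓ) = movesWord (bbMoves isA' ℓ')) : isA = isA' ∧ ℓ = ℓ' := by
  apply bbMoves_injective
  rw [← movesOf_movesWord (bbMoves isA ℓ), h, movesOf_movesWord]

end BuildingBlocks

end Haruspicy

end Literature.Barriers.CriticalPhenomena
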